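/-
Copyright (c) 2026 the pub-hodgecm-mathlib formalisation cell (harness21).  Prover seat hodgecm-mathlib-K2E4-p10 (g10) FOR K2E4-p11 (g9) (KW desk F0P2-p08 (g3)
«KW-car-Haar» threading, 2026-09-05T00:25:32Z), Track B «K2-LIT», #184♮ = hLiu418 = `stmt-HodgeConjecture-24832`; socket #41 KIND W — ★ p863329 (ii)′
`kindW_block_cm_of_letters` RE-KEYED ON ★ p863588 `exists_kindW_carrierLetters_haar`: the SAME head with ONE more ∃-binder `(_ : ∀ T, (νinf T).IsHaarMeasure)` right after `νinf`,
and ONE extra input `Tx` («extra bad places», desk 00:26:13Z) with `Tx ⊆ T₀` exported as the first conjunct.  THEOREMS ONLY (no `def`, no `instance`, no notation, no named-fact hypothesis, no `sorry`).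
-/
import Summits.HodgeConjecture.HodgeConjecture.Theorems.K2LiuKindWBlockOfRecordCMOfLetters         -- ★ p863329 (K2E4-p11 (g9)) (ii)′ — its imports carry every payer used below; ★ p863588 `…CarrierOfRecord` ED. 2 via ★ `…KindWOfRecordLocal`
import HarnessLib

/-!
# Crux `HLiu418`, socket #41, KIND W — `K2LiuKindWBlockOfRecordCMOfLettersHaar`: (ii)′ WITH THE HAAR CLAUSE ON THE ARCHIMEDEAN CARRIERS THREADED

Cell `hodgecm-mathlib`, crux item hLiu418 = `stmt-HodgeConjecture-24832` (helper lane `--supports … --as helper`, count-neutral), route of record `HCCMUnconditional`;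
squad K2 ∕ K2Liu, road `K2_Liu`, socket #41, KIND W block; KW desk F0P2-p08 (g3); consumer K2E3-typ2 (g2)'s tie (v26 pattern `⟨T₀, νv, hνh, hνσ, νinf, hνinfH, hνinfσ, hνK, hmap, hT₀, hKW⟩`).
WHY.  The joint integrability letter `hint` is now ★ by name (★ `hint_joint_of_reading` ∘ ★ `hintArch_of_std`, F0P2-p08 ∕ K2Liu-p11) GIVEN that the archimedean carrier `νinf T` is a
HAAR measure; ★ p862988's carrier head hid that clause, ★ p863588 (ED. 2) `exists_kindW_carrierLetters_haar` exports it as the first conjunct of the `νinf` block.  THIS FILE is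
★ (ii)′ `K2LiuKindWBlockOfRecordCMOfLetters.kindW_block_cm_of_letters` (K2E4-p11 (g9)) VERBATIM — binders :96–107, `∀`-letters :118–180, 13-slot conclusion :181–199, proof :200–253 —
except (a) the ∃-carrier prefix carries `(_ : ∀ T, (νinf T).IsHaarMeasure)` right after `νinf`, (b) ONE extra input `(Tx : Finset (HeightOneSpectrum (𝓞 (Fp L))))` («extra bad places»,
KW desk 00:26:13Z: the (KW-fac) readings hold for `T₀ ⊇ S₀`, the tie passes `Tx := S₀`) with `Tx ⊆ T₀` exported as the FIRST conjunct (inside: ★ p863201's input set is enlarged to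
`T₀ᶜᵃʳʳ ∪ Tx`, `hχ` restricted — every carrier letter is monotone in the bad set), and (c) the proof's carrier source is ★ `exists_kindW_carrierLetters_haar` (projections re-keyed:
`h5.1` = the Haar clause, `h5.2.1` = σ-finiteness, `h5.2.2.1` = `hmap`, `h5.2.2.2` = `hχ`).  Generator `work/mk_haar.py` (tree-byte splice).  A sibling module (not an edition of
★ (ii)′: the head's TYPE changes), typed by K2E4-p10 for K2E4-p11 per the desk's one-writer rule; ★ (ii)′ untouched.
**`kindW_block_cm_of_letters_haar (…) (Tx)`**: `∃ T₀ νv (Haar) (σ-finite) νinf (HAAR) (σ-finite), Tx ⊆ T₀ ∧ hνK ∧ hmap ∧ hχ ∧ ∀ {fT} hfac {m} Finf Ffin hFinf hFfin hFinf0 hPart ‹(iii-fin)›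
‹(iii-arch)›, ‹13-slot KW block›` — letters and payers exactly as ★ (ii)′'s module header lists them.
[CasselsFrohlichANT1967, Ch. XV (Tate) §3.3], [KudlaRallis1994, §1–§2], [Tan1999, §2–§4], [Shimura1982, §3], [Shimura1997, §18.4 Prop. 18.14, §19], [MoeglinWaldspurger1995, II.1.7, IV.1.9].
HONEST LABEL.  Count-neutral helper; it retires nothing by itself: `HC_CM` is proved only modulo the 7 printed citations (2 remaining named inputs:
hLiu418 = `stmt-HodgeConjecture-24832`, h413 = `stmt-HodgeConjecture-24833`) until rung 0 closes.
-/

set_option autoImplicit false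
set_option linter.dupNamespace false -- the mandated namespace repeats `HodgeConjecture.HodgeConjecture`

noncomputable section

open scoped Matrix BigOperators NNReal ENNReal ComplexConjugate RestrictedProduct
-- `Classical` is needed to see the Mathlib normed-ring instances on `mixedSpace L` (note H5 of ★ `AdelicGLnGlue`; as the TOP's `hτ`)
open scoped Classical
open NumberField NumberField.InfinitePlace IsDedekindDomain MeasureTheory Measure
open Literature.NumberTheory.Automorphic Literature.NumberTheory.GaloisRepresentations Literature.NumberTheory.LFunctions
open Literature.NumberTheory.Automorphic.UnitaryGroup (archAt archPart archLocal)
open Literature.NumberTheory.GelbartRogawski1991 Literature.NumberTheory.GelbartRogawski1991.GRConstruction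
open Literature.NumberTheory.K2Lit.SiegelDoubled Literature.NumberTheory.K2Lit.PlaceSplitting
open Literature.MeasureTheory.RestrictedProduct
open Literature.Topology.Algebra.RestrictedProduct (inH)
open Literature.NumberTheory.Automorphic.IdeleClassGroup (toHeckeCharacter isUnitary_toHeckeCharacter IsConjugateSymplectic)
open Summit.HodgeConjecture.HodgeConjecture.Cruxes.HLiu418.K2LiuSiegelUnipotentLocalDefs
open Summit.HodgeConjecture.HodgeConjecture.Cruxes.HLiu418.K2LiuSiegelUnipotentSplitAtDefs
open Summit.HodgeConjecture.HodgeConjecture.Cruxes.HLiu418.K2LiuSiegelUnipotentFourierDefs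
open Summit.HodgeConjecture.HodgeConjecture.Cruxes.HLiu418.K2LiuSiegelEisensteinKindWLetters (kindWPlaces kindWFinset)
open Summit.HodgeConjecture.HodgeConjecture.Cruxes.HLiu418.K2LiuSiegelEisensteinKindWOfRecordLocal (kindW_block_of_record_local)
open Summit.HodgeConjecture.HodgeConjecture.Cruxes.HLiu418.K2LiuKindWCarrierOfRecord (exists_kindW_carrierLetters)
open Summit.HodgeConjecture.HodgeConjecture.Cruxes.HLiu418.K2LiuKindWGoodPlaceFactorCofinite (exists_finset_hJ_toHeckeCharacter)
open Summit.HodgeConjecture.HodgeConjecture.Cruxes.HLiu418.K2LiuKindWFinitePartLettersOfRecord (hfsupp_of_levelLetters hfsize_of_placeLetters hdelta_eq_zero_off)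
open Summit.HodgeConjecture.HodgeConjecture.Cruxes.HLiu418.K2LiuSiegelEisensteinKindWArchAdapter (harch_of_blockLetters)

open Summit.HodgeConjecture.HodgeConjecture.Cruxes.HLiu418.K2LiuKindWCarrierOfRecord (exists_kindW_carrierLetters_haar)

namespace Summit.HodgeConjecture.HodgeConjecture.Cruxes.HLiu418.K2LiuKindWBlockOfRecordCMOfLettersHaar

/-- **THE KIND-W PAYER HEAD WITH ITS CARRIERS BUILT INSIDE — ARCHIMEDEAN CARRIERS HAAR — AND THE LETTERS `hJ`, `hfsupp`, `hfsize`, `harch` DISCHARGED BY NAME.**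
★ (ii)′ `kindW_block_cm_of_letters` VERBATIM with ONE more ∃-binder — `νinf T` IS A HAAR MEASURE for every finite `T` (★ p863588 `exists_kindW_carrierLetters_haar`), so the joint
integrability letter `hint` of the local-letters road is payable by name (★ `hint_joint_of_reading`) — and ONE extra input `Tx` of «extra bad places» absorbed into the head's `T₀`
(`Tx ⊆ T₀` exported first; the tie passes the (KW-fac) reading's `S₀`).  Proof: ★ (ii)′'s, carriers from ★ `exists_kindW_carrierLetters_haar` ⟶ `hJ` ★ p863201 at the input set
`T₀ᶜᵃʳʳ ∪ Tx` (`T₀ := U₁ ⊇ Tx`) ⟶ `hfsupp`∕`hfsize` ★ p863047 ⟶ `harch` ★ p863137 ⟶ ★ p863069 `kindW_block_of_record_local`.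
[cite: KudlaRallis1994, §1–§2] [cite: Tan1999, §4 Prop. 4.8] [cite: Shimura1982, §3] [cite: Shimura1997, §18.1 (18.4), §18.4 Prop. 18.14, §19]
[cite: GelbartRogawski1991, §3.1 (3.1.3)] [cite: Liu2021, Def. 4.1, Rem. 4.4] [cite: CasselsFrohlichANT1967, Ch. XV (Tate) §3.3] [cite: MoeglinWaldspurger1995, II.1.7, IV.1.9] -/
theorem kindW_block_cm_of_letters_haar
    (L : Type) [Field L] [NumberField L] [IsCMField L] {n : ℕ} (e : Fin 2 × Fin 1 ≃ Fin n)
    (dV : Fin 2 → L) (hdV : ∀ i, IsCMField.complexConj L (dV i) = dV i) (hdV0 : ∀ i, dV i ≠ 0)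
    (dW : Fin 1 → L) (hdW : ∀ i, IsCMField.complexConj L (dW i) = dW i) (hdW0 : ∀ i, dW i ≠ 0)
    (lam : IdeleClassGroup L →ₜ* Circle) (hlam : IsConjugateSymplectic L lam)
    (𝒦 : IwasawaDatum L e dV hdV dW hdW) (f : ℂ → HA L e dV hdV dW hdW → ℂ)
    (hstd : IsStandardSectionFamily 𝒦 (toHeckeCharacter L lam⁻¹) f) (hcont : ∀ s, Continuous (f s))
    [MeasurableSpace (unipDelta L e dV hdV dW hdW)] [BorelSpace (unipDelta L e dV hdV dW hdW)]
    (νN : Measure (unipDelta L e dV hdV dW hdW)) [νN.IsHaarMeasure]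
    [DecidableEq (HeightOneSpectrum (𝓞 (Fp L)))]
    [MeasurableSpace (unipDeltaArch L e dV hdV dW hdW)] [BorelSpace (unipDeltaArch L e dV hdV dW hdW)]
    [∀ v : HeightOneSpectrum (𝓞 (Fp L)), MeasurableSpace (unipDeltaLoc L e dV hdV dW hdW v)]
    [∀ v : HeightOneSpectrum (𝓞 (Fp L)), BorelSpace (unipDeltaLoc L e dV hdV dW hdW v)]
    (Tx : Finset (HeightOneSpectrum (𝓞 (Fp L)))) :
    ∃ (T₀ : Finset (HeightOneSpectrum (𝓞 (Fp L))))
      (νv : ∀ v : HeightOneSpectrum (𝓞 (Fp L)), Measure (unipDeltaLoc L e dV hdV dW hdW v)) (_ : ∀ v, (νv v).IsHaarMeasure) (_ : ∀ v, SigmaFinite (νv v))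
      (νinf : Finset (HeightOneSpectrum (𝓞 (Fp L))) → Measure (unipDeltaArch L e dV hdV dW hdW)) (_ : ∀ T, (νinf T).IsHaarMeasure) (_ : ∀ T, SigmaFinite (νinf T)),
      Tx ⊆ T₀ ∧
      (∀ v, νv v (((inH (fun v => UnitaryGroup.localInt L (IsCMField.complexConj L) (n + n) (hermD L e dV hdV dW hdW) v)
      (fun v => unipDeltaLoc L e dV hdV dW hdW v) v) : Subgroup (unipDeltaLoc L e dV hdV dW hdW v)) : Set (unipDeltaLoc L e dV hdV dW hdW v)) = 1) ∧
      (∀ T : Finset (HeightOneSpectrum (𝓞 (Fp L))), Measure.map (unipDeltaSplitAt L e dV hdV dW hdW T) νN =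
      (νinf T).prod ((Measure.pi fun v : T => νv v.1).prod
        (rpMeasure (fun v : {v : HeightOneSpectrum (𝓞 (Fp L)) // v ∉ T} => ((inH (fun v => UnitaryGroup.localInt L (IsCMField.complexConj L) (n + n) (hermD L e dV hdV dW hdW) v)
          (fun v => unipDeltaLoc L e dV hdV dW hdW v) v.1 : Subgroup (unipDeltaLoc L e dV hdV dW hdW v.1)) : Set (unipDeltaLoc L e dV hdV dW hdW v.1))) (fun v => νv v.1) ∅))) ∧
      (∀ v, v ∉ T₀ → ∀ w' : UnitaryGroup.PlacesOver L v, (toHeckeCharacter L lam⁻¹).IsUnramifiedAt w'.1) ∧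
    ∀
        {fT : ∀ T : Finset (HeightOneSpectrum (𝓞 (Fp L))), ℂ → UnitaryGroup.arch (Fp L) L (IsCMField.complexConj L) (n + n) (hermD L e dV hdV dW hdW) ×
          (Π v : T, UnitaryGroup.localPi L (IsCMField.complexConj L) (n + n) (hermD L e dV hdV dW hdW) v.1) → ℂ}
        (hfac : ∀ T : Finset (HeightOneSpectrum (𝓞 (Fp L))), T₀ ⊆ T → IsFactorizableOff L e dV hdV dW hdW T (toHeckeCharacter L lam⁻¹) f (fT T))
        -- the CONTINUED local letters (by value) and their holomorphy on `{0 < re s}`, the convention at singular indices, and the half-plane identity `hPart`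
        {m : ℕ} (Finf : Fin m → skewMatrices ((IsCMField.complexConj L : L ≃ₐ[Fp L] L) : L →+* L) ((gramR L e dV hdV dW hdW).map (algebraMap (Fp L) L)) → ℂ → HA L e dV hdV dW hdW → ℂ)
        (Ffin : Fin m → skewMatrices ((IsCMField.complexConj L : L ≃ₐ[Fp L] L) : L →+* L) ((gramR L e dV hdV dW hdW).map (algebraMap (Fp L) L)) → HA L e dV hdV dW hdW →
          HeightOneSpectrum (𝓞 (Fp L)) → ℂ → ℂ)
        (hFinf : ∀ j S (h : HA L e dV hdV dW hdW), DifferentiableOn ℂ (fun s => Finf j S s h) {s : ℂ | 0 < s.re})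
        (hFfin : ∀ j S (h : HA L e dV hdV dW hdW) v, DifferentiableOn ℂ (Ffin j S h v) {s : ℂ | 0 < s.re})
        (hFinf0 : ∀ (j : Fin m) (S : skewMatrices ((IsCMField.complexConj L : L ≃ₐ[Fp L] L) : L →+* L) ((gramR L e dV hdV dW hdW).map (algebraMap (Fp L) L)))
          (s : ℂ) (h : HA L e dV hdV dW hdW), (S : Matrix (Fin n) (Fin n) L).det = 0 → Finf j S s h = 0)
        (hPart : ∀ (S : skewMatrices ((IsCMField.complexConj L : L ≃ₐ[Fp L] L) : L →+* L) ((gramR L e dV hdV dW hdW).map (algebraMap (Fp L) L))) (h : HA L e dV hdV dW hdW) (s : ℂ),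
          (n : ℝ) / 2 < s.re → (S : Matrix (Fin n) (Fin n) L).det ≠ 0 →
          K2LiuSiegelEisensteinKindWLetters.kindWPart L e dV hdV dW hdW (kindWFinset L e dV hdV dW hdW T₀ (S : Matrix (Fin n) (Fin n) L) h)
              (νinf (kindWFinset L e dV hdV dW hdW T₀ (S : Matrix (Fin n) (Fin n) L) h)) νv
              (fT (kindWFinset L e dV hdV dW hdW T₀ (S : Matrix (Fin n) (Fin n) L) h)) (S : Matrix (Fin n) (Fin n) L) s h =
            ∑ j, Finf j S s h * ∏ v ∈ kindWFinset L e dV hdV dW hdW T₀ (S : Matrix (Fin n) (Fin n) L) h, Ffin j S h v s)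
        -- (iii-fin) THE PER-PLACE LEVEL LETTERS (★ p863047 `hfsupp_of_levelLetters`' inputs at the data of record)
        (lev : HA L e dV hdV dW hdW → HeightOneSpectrum (𝓞 L) → ℕ) (Tδ₀ : Finset (HeightOneSpectrum (𝓞 L))) (δ₀ : HeightOneSpectrum (𝓞 L) → ℕ) (hδ₀ : ∀ w ∉ Tδ₀, δ₀ w = 0) (k : ℕ)
        (hlev : ∀ (h : HA L e dV hdV dW hdW) (w : HeightOneSpectrum (𝓞 L)),
          ((Ideal.absNorm w.asIdeal : ℕ) : ℝ) ^ lev h w ≤ ((Ideal.absNorm w.asIdeal : ℕ) : ℝ) ^ δ₀ w * (GLn.localHeight (n + n) L w (h : GL (Fin (n + n)) (AdeleRing (𝓞 L) L)) : ℝ) ^ k)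
        (Tc : Finset (HeightOneSpectrum (𝓞 L))) (c : HeightOneSpectrum (𝓞 L) → ℕ) (hc : ∀ w ∉ Tc, c w = 0)
        (hsuppLoc : ∀ (v : HeightOneSpectrum (𝓞 (Fp L))) (j : Fin m)
          (S : skewMatrices ((IsCMField.complexConj L : L ≃ₐ[Fp L] L) : L →+* L) ((gramR L e dV hdV dW hdW).map (algebraMap (Fp L) L))) (s : ℂ) (h : HA L e dV hdV dW hdW),
          v ∈ kindWFinset L e dV hdV dW hdW T₀ (S : Matrix (Fin n) (Fin n) L) h → 0 < s.re → Ffin j S h v s ≠ 0 →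
          ∀ (w : UnitaryGroup.PlacesOver L v) (a b : Fin n),
            Valued.v ((((S : Matrix (Fin n) (Fin n) L) a b : L)) : w.1.adicCompletion L) ≤ WithZero.exp (((lev h w.1 + c w.1 : ℕ) : ℤ)))
        -- (iii-fin) THE PER-PLACE SIZE LETTERS (★ p863047 `hfsize_of_placeLetters`' inputs at the data of record, `τ S := ‖(ι_∞ S_{ij})‖`)
        (k₂ k₃ : ℕ) (Tβ : Finset (HeightOneSpectrum (𝓞 L)))
        (hsizeLoc : ∀ z : ℂ, 0 < z.re → ∃ (r : ℝ) (k₁ : ℕ) (β : HeightOneSpectrum (𝓞 L) → ℕ), 0 < r ∧ (∀ w ∉ Tβ, β w = 0) ∧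
          ∀ (j : Fin m) (S : skewMatrices ((IsCMField.complexConj L : L ≃ₐ[Fp L] L) : L →+* L) ((gramR L e dV hdV dW hdW).map (algebraMap (Fp L) L))) (s : ℂ),
          dist s z < r → ∀ (h : HA L e dV hdV dW hdW) (v : HeightOneSpectrum (𝓞 (Fp L))), v ∈ kindWFinset L e dV hdV dW hdW T₀ (S : Matrix (Fin n) (Fin n) L) h →
          ∀ (dS dA : HeightOneSpectrum (𝓞 L) → ℕ),
            (∀ (w : UnitaryGroup.PlacesOver L v) (a b : Fin n), Valued.v ((((S : Matrix (Fin n) (Fin n) L) a b : L)) : w.1.adicCompletion L) ≤ WithZero.exp ((dS w.1 : ℕ) : ℤ)) →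
            (∀ (w : UnitaryGroup.PlacesOver L v) (a b : Fin n), Valued.v ((((S : Matrix (Fin n) (Fin n) L)⁻¹ a b : L)) : w.1.adicCompletion L) ≤ WithZero.exp ((dA w.1 : ℕ) : ℤ)) →
            ‖Ffin j S h v s‖ ≤ ∏ w : UnitaryGroup.PlacesOver L v,
              ((Ideal.absNorm w.1.asIdeal : ℕ) : ℝ) ^ β w.1 * (GLn.localHeight (n + n) L w.1 (h : GL (Fin (n + n)) (AdeleRing (𝓞 L) L)) : ℝ) ^ k₁ *
                ((Ideal.absNorm w.1.asIdeal : ℕ) : ℝ) ^ (k₂ * dS w.1 + k₃ * dA w.1))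
        -- (iii-arch) THE INDEX FRAMES (★ FILE 2d), THE ARCHIMEDEAN FRAMES (★ G7-C), AND THE POINTWISE BLOCK LETTER («Φ6b-ind»; ★ p863137 `harch_of_blockLetters`' inputs)
        {Sinf : Type} [Fintype Sinf]
        (φ : Sinf → (L →+* ℂ)) (A B Ainv Binv : Sinf → Matrix (Fin n) (Fin n) ℂ) {Mf : ℝ} (hMf : 1 ≤ Mf)
        (hA : ∀ σ i j, ‖A σ i j‖ ≤ Mf) (hB : ∀ σ i j, ‖B σ i j‖ ≤ Mf) (hAe : ∀ σ i j, ‖Ainv σ i j‖ ≤ Mf) (hBe : ∀ σ i j, ‖Binv σ i j‖ ≤ Mf)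
        (hAi : ∀ σ, Ainv σ * A σ = 1) (hBi : ∀ σ, B σ * Binv σ = 1) (hcover : ∀ w : InfinitePlace L, ∃ σ, InfinitePlace.mk (φ σ) = w)
        (w : Sinf → {w : InfinitePlace L // IsComplex w}) (hw : ∀ σ, (IsCMField.complexConj L : L ≃ₐ[Fp L] L) • (w σ).1 = (w σ).1)
        (er : Fin n ⊕ Fin n ≃ Fin (n + n)) (T Tinv : Sinf → Matrix (Fin n ⊕ Fin n) (Fin n ⊕ Fin n) ℂ) (hT : ∀ σ, T σ * Tinv σ = 1)
        {M : ℝ} (hM : 1 ≤ M) (hTe : ∀ σ i j, ‖T σ i j‖ ≤ M) (hTe' : ∀ σ i j, ‖Tinv σ i j‖ ≤ M)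
        (hBL : ∀ z : ℂ, 0 < z.re → ∃ (cg Ng N'g Kt C a r : ℝ), 0 < cg ∧ 0 ≤ Ng ∧ 0 ≤ N'g ∧ 1 ≤ Kt ∧ 0 ≤ C ∧ 0 ≤ a ∧ 0 < r ∧
          ∀ (j : Fin m) (S : skewMatrices ((IsCMField.complexConj L : L ≃ₐ[Fp L] L) : L →+* L) ((gramR L e dV hdV dW hdW).map (algebraMap (Fp L) L))) (s : ℂ),
          dist s z < r → (S : Matrix (Fin n) (Fin n) L).det ≠ 0 →
          ∀ (h : HA L e dV hdV dW hdW) (y b d : Sinf → Matrix (Fin n) (Fin n) ℂ) (κ κ' : Sinf → Matrix (Fin n ⊕ Fin n) (Fin n ⊕ Fin n) ℂ),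
          (∀ σ, κ σ * κ' σ = 1) → (∀ σ, κ' σ * κ σ = 1) → (∀ σ i j, ‖κ σ i j‖ ≤ M) → (∀ σ i j, ‖κ' σ i j‖ ≤ M) →
          (∀ σ, T σ * Matrix.reindex er.symm er.symm
              ((((archAt (Fp L) L (IsCMField.complexConj L : L ≃ₐ[Fp L] L) (n + n) (hermD L e dV hdV dW hdW) (w σ) (hw σ) (IsCMField.complexConj_ne_one L)
                  (archPart (Fp L) L (IsCMField.complexConj L : L ≃ₐ[Fp L] L) (n + n) (hermD L e dV hdV dW hdW) h) :
                  archLocal L (n + n) (hermD L e dV hdV dW hdW) (w σ)) : GL (Fin (n + n)) ℂ) : Matrix (Fin (n + n)) (Fin (n + n)) ℂ)) * Tinv σ =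
            Matrix.fromBlocks (y σ) (b σ) 0 (d σ) * κ σ) →
          ∃ t : Sinf → ℝ,
            (∀ σ a b, ‖((y σ)ᴴ * (A σ * ((S : Matrix (Fin n) (Fin n) L).map (φ σ)) * B σ) * y σ) a b‖ ≤ t σ) ∧
            (∀ σ, t σ ≤ Kt * ∑ a, ∑ b, ‖((y σ)ᴴ * (A σ * ((S : Matrix (Fin n) (Fin n) L).map (φ σ)) * B σ) * y σ) a b‖) ∧
            ‖Finf j S s h‖ ≤ C * adelicHeightGL (n + n) L (h : GL (Fin (n + n)) (AdeleRing (𝓞 L) L)) ^ a *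
              ∏ σ, (Real.exp (-(cg * t σ)) * (1 + t σ) ^ Ng *
                (1 + ‖((y σ)ᴴ * (A σ * ((S : Matrix (Fin n) (Fin n) L).map (φ σ)) * B σ) * y σ).det‖ ^ (-N'g)))),
    ∃ (A : skewMatrices ((IsCMField.complexConj L : L ≃ₐ[Fp L] L) : L →+* L) ((gramR L e dV hdV dW hdW).map (algebraMap (Fp L) L)) → ℂ → HA L e dV hdV dW hdW → ℂ)
      (U : skewMatrices ((IsCMField.complexConj L : L ≃ₐ[Fp L] L) : L →+* L) ((gramR L e dV hdV dW hdW).map (algebraMap (Fp L) L)) → HA L e dV hdV dW hdW →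
        Set (HeightOneSpectrum (𝓞 ↥(maximalRealSubfield L)))),
      (∀ S : skewMatrices ((IsCMField.complexConj L : L ≃ₐ[Fp L] L) : L →+* L) ((gramR L e dV hdV dW hdW).map (algebraMap (Fp L) L)),
        (S : Matrix (Fin n) (Fin n) L).det ≠ 0 → ∀ (s : ℂ) (h : HA L e dV hdV dW hdW), (n : ℝ) / 2 < s.re →
          whittakerDelta L e dV hdV dW hdW νN (S : Matrix (Fin n) (Fin n) L) (f s) h =
            A S s h * (partialStandardL (U S h) (fun _ => {1}) (2 * s + 1) *
              partialStandardL (U S h) (fun v => {(quadraticHeckeCharCM L).valueAtUniformizer v}) (2 * s + 2))⁻¹) ∧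
      (∀ S (h : HA L e dV hdV dW hdW), DifferentiableOn ℂ (fun s => A S s h) {s : ℂ | 0 < s.re}) ∧
      ∃ (τ : skewMatrices ((IsCMField.complexConj L : L ≃ₐ[Fp L] L) : L →+* L) ((gramR L e dV hdV dW hdW).map (algebraMap (Fp L) L)) → ℝ) (NW : ℕ),
        (∀ S : skewMatrices ((IsCMField.complexConj L : L ≃ₐ[Fp L] L) : L →+* L) ((gramR L e dV hdV dW hdW).map (algebraMap (Fp L) L)),
          ‖(fun i j => NumberField.mixedEmbedding L ((S : Matrix (Fin n) (Fin n) L) i j))‖ ≤ τ S) ∧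
        (∀ z : ℂ, 0 < z.re → ∃ C a c a' r : ℝ, 0 ≤ C ∧ 0 ≤ a ∧ 0 < c ∧ 0 ≤ a' ∧ 0 < r ∧ ∀ S (s : ℂ), dist s z < r → ∀ h : HA L e dV hdV dW hdW,
          ‖A S s h‖ ≤ C * adelicHeightGL (n + n) L (h : GL (Fin (n + n)) (AdeleRing (𝓞 L) L)) ^ a *
            (Real.exp (-(c * adelicHeightGL (n + n) L (h : GL (Fin (n + n)) (AdeleRing (𝓞 L) L)) ^ (-a') * τ S)) * (1 + τ S) ^ NW)) ∧
        ∃ CW κ : ℝ, 0 < CW ∧ 0 ≤ κ ∧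
          ∀ S (s : ℂ) (h : HA L e dV hdV dW hdW), 0 < s.re → A S s h ≠ 0 →
            ∃ D : ℕ, 1 ≤ D ∧ (D : ℝ) ≤ CW * adelicHeightGL (n + n) L (h : GL (Fin (n + n)) (AdeleRing (𝓞 L) L)) ^ κ ∧
              ∀ i j, IsIntegral ℤ ((D : L) * (S : Matrix (Fin n) (Fin n) L) i j) := by
  -- the frame is rank two: `n = 2`
  have hn2 : n = 2 := by
    have h2 : Fintype.card (Fin 2 × Fin 1) = Fintype.card (Fin n) := Fintype.card_congr e
    simp only [Fintype.card_prod, Fintype.card_fin] at h2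
    omega
  subst hn2
  haveI : NeZero (2 + 2) := ⟨by omega⟩
  -- the carriers of record WITH THE HAAR CLAUSE on `νinf` (★ p863588 `exists_kindW_carrierLetters_haar`), unpacked by projections
  have h := exists_kindW_carrierLetters_haar L e dV hdV dW hdW (toHeckeCharacter L lam⁻¹) νN
  have h1 := h.choose_spec
  have h2 := h1.choose_spec
  have h3 := h2.choose_spec
  have h4 := h3.choose_spec
  have h5 := h4.2.choose_spec
  haveI := h2.choose
  haveI := h3.choose
  -- `hJ` off a finite `U₁ ⊇ T₀ᶜᵃʳʳ ∪ Tx` (★ p863201 at the ENLARGED input set, `hχ` restricted; no kit, no by-value letter); the head's `T₀ := U₁ ⊇ Tx`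
  have hχx : ∀ v, v ∉ h.choose ∪ Tx → ∀ w' : UnitaryGroup.PlacesOver L v, (toHeckeCharacter L lam⁻¹).IsUnramifiedAt w'.1 :=
    fun v hv => h5.2.2.2 v fun h' => hv (Finset.mem_union_left _ h')
  have hU := exists_finset_hJ_toHeckeCharacter L e dV hdV dW hdW hdV0 hdW0 lam hlam (h.choose ∪ Tx) h1.choose h4.1 hχx
  have hU₁ : h.choose ∪ Tx ⊆ hU.choose := hU.choose_spec.1
  have hJ := hU.choose_spec.2
  refine ⟨hU.choose, h1.choose, h2.choose, h3.choose, h4.2.choose, h5.1, h5.2.1, Finset.subset_union_right.trans hU₁, h4.1, h5.2.2.1,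
    fun v hv => hχx v fun h' => hv (hU₁ h'), ?_⟩
  intro fT hfac m Finf Ffin hFinf hFfin hFinf0 hPart lev Tδ₀ δ₀ hδ₀ k hlev Tc c hc hsuppLoc k₂ k₃ Tβ hsizeLoc Sinf _ φ A B Ainv Binv Mf hMf hA hB hAe hBe hAi hBi hcover
    w hw er T Tinv hT M hM hTe hTe' hBL
  -- `hfsupp` ★ p863047 (`δ := δ₀ + c` off `T_{δ₀} ∪ T_c`)
  have hfsupp := hfsupp_of_levelLetters L (N := 2 + 2)
    (fun S : skewMatrices ((IsCMField.complexConj L : L ≃ₐ[Fp L] L) : L →+* L) ((gramR L e dV hdV dW hdW).map (algebraMap (Fp L) L)) => (S : Matrix (Fin 2) (Fin 2) L))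
    (fun x : HA L e dV hdV dW hdW => (x : GL (Fin (2 + 2)) (AdeleRing (𝓞 L) L)))
    (fun S x => kindWFinset L e dV hdV dW hdW hU.choose (S : Matrix (Fin 2) (Fin 2) L) x) (fun v j S s x => Ffin j S x v s) lev δ₀ k hlev c hsuppLoc
  beta_reduce at hfsupp
  -- `hfsize` ★ p863047 (global exponents, a fortiori local)
  have hfsizeG := hfsize_of_placeLetters L (N := 2 + 2)
    (fun S : skewMatrices ((IsCMField.complexConj L : L ≃ₐ[Fp L] L) : L →+* L) ((gramR L e dV hdV dW hdW).map (algebraMap (Fp L) L)) => (S : Matrix (Fin 2) (Fin 2) L))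
    (fun x : HA L e dV hdV dW hdW => (x : GL (Fin (2 + 2)) (AdeleRing (𝓞 L) L)))
    (fun S x => kindWFinset L e dV hdV dW hdW hU.choose (S : Matrix (Fin 2) (Fin 2) L) x) (fun v j S s x => Ffin j S x v s)
    (fun S => ‖(fun i j => NumberField.mixedEmbedding L ((S : Matrix (Fin 2) (Fin 2) L) i j))‖) (fun S => le_rfl) k₂ k₃ Tβ hsizeLoc
  beta_reduce at hfsizeG
  have hfsize : ∀ z : ℂ, 0 < z.re → ∃ (N₂ N₃ : ℕ) (C a r : ℝ), 0 ≤ C ∧ 0 ≤ a ∧ 0 < r ∧ ∀ (j : Fin m)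
      (S : skewMatrices ((IsCMField.complexConj L : L ≃ₐ[Fp L] L) : L →+* L) ((gramR L e dV hdV dW hdW).map (algebraMap (Fp L) L))) (s : ℂ),
      dist s z < r → ∀ (x : HA L e dV hdV dW hdW) (D : ℕ), 1 ≤ D → (∀ a b, IsIntegral ℤ ((D : L) * (S : Matrix (Fin 2) (Fin 2) L) a b)) →
      ‖∏ v ∈ kindWFinset L e dV hdV dW hdW hU.choose (S : Matrix (Fin 2) (Fin 2) L) x, Ffin j S x v s‖ ≤
        C * adelicHeightGL (2 + 2) L (x : GL (Fin (2 + 2)) (AdeleRing (𝓞 L) L)) ^ a *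
          (1 + ‖(fun i j => NumberField.mixedEmbedding L ((S : Matrix (Fin 2) (Fin 2) L) i j))‖) ^ N₂ * (D : ℝ) ^ N₃ := by
    intro z hz
    have hh := hfsizeG z hz   -- (an `obtain` straight on the application re-elaborates the instance-laden type and times out)
    obtain ⟨C, a, r, hC, ha, hr, hb⟩ := hh
    refine ⟨2 * Module.finrank ℚ L * k₃, Module.finrank ℚ L * (k₂ + 2 * k₃), C, a, r, hC, ha, hr, ?_⟩
    intro j S s hs x D hD hDi
    exact hb j S s hs x D hD hDi
  -- `harch` ★ p863137 (`hc` by Mathlib `IsCMField.complexConj_ne_one`)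
  have harch := harch_of_blockLetters L e dV hdV dW hdW (IsCMField.complexConj_ne_one L) φ A B Ainv Binv hMf hA hB hAe hBe hAi hBi hcover w hw er T Tinv hT hM hTe hTe'
    Finf hFinf0 hBL
  -- ★ p863069 `kindW_block_of_record_local` at `T₀ := U₁`
  exact kindW_block_of_record_local L e dV hdV hdV0 dW hdW hdW0 lam 𝒦 f hstd hcont νN hU.choose h1.choose h4.1 h4.2.choose h5.2.1 h5.2.2.1
    (fun v hv => hχx v fun h' => hv (hU₁ h')) hfac hJ Finf Ffin hFinf hFfin hPart (Tδ₀ ∪ Tc) (δ₀ + c) (hdelta_eq_zero_off L Tδ₀ Tc δ₀ c hδ₀ hc) k hfsupp harch hfsize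

end Summit.HodgeConjecture.HodgeConjecture.Cruxes.HLiu418.K2LiuKindWBlockOfRecordCMOfLettersHaar

end
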